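import Summits.QuantumFields.YangMills.Theorems.BalabanUVNodesKLCPrAtHierFrameGuarded
import Summits.QuantumFields.YangMills.Theorems.BalabanUVNodesN07QCplxOpOntoGuarded
import Summits.QuantumFields.YangMills.Theorems.BalabanUVNodesN07AtRecordTwoTier
import HarnessLib

/-!
# THE GL PIN, IN-CLASS EDITION — ✓`…_of_entryRows_guarded` (✓p835253) with {W1}'s un-framed onto row `hqon` DISCHARGED from the pin's own class letter
# `hcl : InUkClassB11 F N K k ε₀ U₀` (dag-n07-e ✓p835338), and the pin READ AT THE MINIMISER OF RECORD `UkSel … V` ∕ its centred rooted gauge `rootGaugeC k (UkSel … V)`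

Cell `pub-ymgap` ∕ `ym-nodeO-ideate`, porter lineage `ymgap-nodeO-port-PTB-1` (gen 13), arrival of record = dag-n07-e g39 ✓p835338 + v1.1 ✓p835435 `Theorems/BalabanUVNodesN07QCplxOpOntoGuarded.lean`
(«the GL pin's `hqon`∕framed `hQ` is supplied by name at every `U₀ ∈ bgReg`, at `UkSel`, at `rootGaugeC k (UkSel …)` — one-liner instances, yours to write», pub-ymgap INBOX
2026-08-31T21:40Z∕21:42Z).  `--kind proof --supports stmt-QuantumFields-27238 --as helper`; count-neutral; NEW basename; ✓`…KLCPrAtHierFrameGuarded`, ✓`…N07QCplxOpOntoGuarded`,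
✓`…N07AtRecordTwoTier` NOT edited.  [B7] = [Balaban1985Averaging]; [B9] = [Balaban1985BackgroundPropagators]; [B11] = [Balaban1985Variational]; [B12] = [Balaban1987RG1].

WHAT IS PROVED (0 def, 0 sorry, axioms standard; ns `Summit.QuantumFields.YangMills.Theorems.KExpOfRecordPr`; node-00, `0 < k ≤ m + K`):
* §0 (glue, [B11] p.278 «the space 𝔘_k is gauge invariant» + Thm 1's uniqueness clause) `inUkClassB11_of_orbitRel` ((2)'s class is constant on residual orbits),
  `inUkClassB11_ukSel_of_uk` (the SELECTOR `UkSel … ε V` lies in (2)'s class at `ε₀` as soon as node00-def-B's `Uk … ε V` does, under `UkExists` + `UniqueUkOrbit`),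
  `inUkClassB11_rootGaugeC_iff` ∕ `inUkClassB11_rootGaugeC_ukSel_of_uk` (same for DEF-1's centred rooted normal form `rootGaugeC k`, the `recordBgFieldC` shape).
* §1 ★★★ `prop4UniformPrAtRecord_node00_of_prop5Clause_hierFrameGLRec_of_entryRows_inClass` — the GL pin ✓`…_of_entryRows_guarded` with ONE CONTENT BINDER FEWER: the un-framed
  onto row `hqon : Function.Surjective (qCplxOp k U₀)` ({W1}'s un-framed half, [B7] Sect. E) is DERIVED inside the statement from the class letter `hcl : InUkClassB11 F N K k ε₀ U₀`
  the pin already displays for its current term (dag-n07-e v1.1 ✓p835435 `qCplxOp_surjective_of_inUkClassB11` = MODULE 142–144 corrector road + lit ✓`InUkClassB11.mem_bgReg`;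
  the framed `hQ` then by ✓`QprOfRecord_surjective_hierFrameGL_of_inUkClassB11` = PT-B ✓p832507 fed with that row), and `0 ≤ ε₀` is dropped (✓`eps_pos_of_inUkClassB11`).  PRICE (displayed, k-free numeric rows): MODULE 144's four ceilings on `ε₀` — `143·((d+4)²∕4)²·ε₀ ≤ 1∕3`,
  `2ε₀ ≤ 2δ_N∕((d+4)L)²`, `stokesConst·2ε₀ < emlWeight∕16`, `stokesConst·2ε₀ < δ_N` (one admissible `ε₀ > 0` per `(d, L, N)`: ✓`N07CritTangentInClass.exists_admissible_eps`).
  LOCATED (dag-n07-e, INBOX 21:42Z): `hqon` does NOT follow from print's (14) `hreg` alone — (14)'s top smallness is `α∕L²`-type while the corrector wants `9α < 1∕(9216·L⁴)` (d = 4).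
* §2 ★★★ `…_of_entryRows_inClass_ukSel` — §1 READ AT THE MINIMISER OF RECORD `U₀ := UkSel F N K k ε V` (lit `Node00.UkSel`, the measurable rooted-gauge selector; DEF-1's
  `recordBgField` is `UkSel F 2 K (k+1) θ.εbg (unitField …)`), the class letter in the consumers' [B11] Thm 1 currency AT THE DATUM `V`: `hex : UkExists F N K k ε V`,
  `huniq : UniqueUkOrbit F N K k ε V`, `hcl : InUkClassB11 F N K k ε₀ (Uk F N K k ε V)` (two radii: selector `ε`, class `ε₀`).
* §3 ★★★ `…_of_entryRows_inClass_rootGaugeC_ukSel` — the same at `U₀ := rootGaugeC k (UkSel F N K k ε V)` (DEF-1's CENTRED normal form `recordBgFieldC := rootGaugeC (k+1) (recordBgField …)`).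
REMAINING displayed letters at the record's background (§2∕§3): `hpos` ({W1} framed half: `Δ_a(Q^{pr}, Q′)` positive), {W2} `h0∕h1` ([B9] Thm 3.12 (3.133) rows), {W3} `hS∕hR`
([B11] (72)–(73)∕(86)–(89)), {W4} `h157` + `r + r ≤ α₁` ([B7] Prop. 5 (157)), the k-free window `hq`, print's (14) `hreg` for the AVERAGED backgrounds `Ū^j(U₀)`, `∀ x, x ∈ Ω_k`, the
three Thm 1 rows `hex∕huniq∕hcl`, the four `ε₀` ceilings, numeric format rows.

HONEST FRAMING.  Glue BY NAME (n07-e's corrector road supplies `hqon`; gauge invariance of (2) moves the class letter along the minimal orbit); {W1} `hpos`, {W2}, {W3}, {W4}, (14)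
`hreg` and the Thm 1 rows are DISPLAYED hypotheses INHABITED NOWHERE at a generic background ∕ at the minimiser of record; nothing of [B7] Prop. 5 ∕ Sect. E, [B9] Thm 3.11 ∕ 3.12,
[B11] Thm 1 ∕ (72)–(73) ∕ Prop. 4 is proved here; the corrector's thresholds are NOT print's `O(L²α₀)`; K0ᴬ ⟨stmt-QuantumFields-27238⟩ NOT closed (0∕2); ⟨27931⟩
CLOSED·IMPLICATION-ONLY; NODE O 0∕1; COUNT 8∕28 · K 1∕4 UNMOVED; one finite `𝕋⁴_{L^K}` programme at fixed ε — NOT continuum ∕ ℝ⁴ ∕ OS ∕ Clay; **the Yang–Mills mass gap (Clay)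
is NOT proved by any of this.**  No `sorry`, `instance`, `notation`, `set_option`; standard axioms.
-/

noncomputable section

open scoped Matrix Matrix.Norms.L2Operator InnerProductSpace ComplexConjugate BigOperators
open Classical

namespace Summit.QuantumFields.YangMills.Theorems.KExpOfRecordPr

open Literature.MathematicalPhysics.QuantumFieldTheory.Balaban1983to89
open Literature.MathematicalPhysics.QuantumFieldTheory.Balaban1983to89.Node00
open Literature.MathematicalPhysics.QuantumFieldTheory.Balaban1983to89.B12GaugeOrbits021 (OrbitRel)
open Literature.MathematicalPhysics.QuantumFieldTheory.Balaban1983to89.BlockAveragingEMLHaarAC (emlWeight)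
open Literature.MathematicalPhysics.QuantumFieldTheory.Balaban1983to89.ExpMeanLog (deltaSU)
open Summit.QuantumFields.YangMills.Theorems.KExpOfRecord (KRecIdx kexpOfRecord)
open T4Continuum BlockAveraging
open B11Eq103H1Complex (SiteL2K)
open B9SectCLatticeCarrier (Bond)
open B11Eq115Space (NegSup NegSize JetSup levWeight levWeight_apply)
open B11Eq111FrakG (nabla115)
open Summit.QuantumFields.YangMills.BalabanUVNodes.N07Prop4LetterHOfThm312 (blkOfBond)
open Summit.QuantumFields.YangMills.BalabanUVNodes.N07KernelEntriesOfRecord (entry0 entry1 nColOp)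
open Summit.QuantumFields.YangMills.BalabanUVNodes.N07KLNOfLocalityRows (blockRow0 blockRow1)
open Summit.QuantumFields.YangMills.BalabanUVNodes.N07AtRecordTwoTier (eps_pos_of_inUkClassB11)
open Summit.QuantumFields.YangMills.Theorems.BlockAvgCorrector (stokesConst)
open Summit.QuantumFields.YangMills.Theorems.N07QCplxOpOntoGuarded (qCplxOp_surjective_of_inUkClassB11 QprOfRecord_surjective_hierFrameGL_of_inUkClassB11)
open Summit.QuantumFields.YangMills.Theorems.RootedGaugeCentred (rootGaugeC orbitRel_rootGaugeC)
open GaugeField (gaugeAct)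

variable (F : T4Family) (N : ℕ) [NeZero N]

/-! ## §0  Glue: [B11] (2)'s class along the minimal orbit — the selector `UkSel` and its centred rooted gauge -/

section Glue

variable {F N} {K k : ℕ} {ε ε₀ : ℝ}

/-- **(2)'s class is constant on residual orbits** ([B11] p.278 «the space 𝔘_k({Ω_j}, ε₀) is gauge invariant», lit ✓`inUkClassB11_gaugeAct_iff`; an `OrbitRel k`-pair differs by a
residual gauge transformation of level `k`). [cite: Balaban1985Variational, (2) p.278; Balaban1987RG1, (0.21) p.256] -/
theorem inUkClassB11_of_orbitRel {U U' : GaugeField (F.P K) 0 (SU N)} (h : OrbitRel k U U') (hU : InUkClassB11 F N K k ε₀ U) :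
    InUkClassB11 F N K k ε₀ U' := by
  obtain ⟨u, _, rfl⟩ := h
  exact (inUkClassB11_gaugeAct_iff u U).2 hU

/-- ★ **THE SELECTOR OF RECORD LIES IN (2)'s CLASS AS SOON AS `U_k(V)` DOES**: under [B11] Thm 1's solvability `UkExists … ε V` and uniqueness `UniqueUkOrbit … ε V` (DISPLAYED),
node00-def-B's `Uk … ε V` and the measurable rooted-gauge selector `UkSel … ε V` lie on ONE residual orbit (lit ✓`orbitRel_Uk_UkSel`), and (2)'s class at any `ε₀` is orbit-constant.
[cite: Balaban1985Variational, Thm 1 p.279, (2) p.278; Balaban1987RG1, (0.21) p.256] -/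
theorem inUkClassB11_ukSel_of_uk (hk : k ≤ (F.P K).m + (F.P K).K) {V : GaugeField (F.P K) k (SU N)} (hex : UkExists F N K k ε V) (huniq : UniqueUkOrbit F N K k ε V)
    (hcl : InUkClassB11 F N K k ε₀ (Uk F N K k ε V)) : InUkClassB11 F N K k ε₀ (UkSel F N K k ε V) :=
  inUkClassB11_of_orbitRel (orbitRel_Uk_UkSel hk hex huniq) hcl

/-- **(2)'s class is blind to DEF-1's centred rooted normal form**: `InUkClassB11 … (rootGaugeC k U) ↔ InUkClassB11 … U` (`rootGaugeC k U = U^{g_U}`, `g_U` the comb transporter).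
[cite: Balaban1985Variational, (2) p.278, (19) p.281] -/
theorem inUkClassB11_rootGaugeC_iff (U : GaugeField (F.P K) 0 (SU N)) : InUkClassB11 F N K k ε₀ (rootGaugeC k U) ↔ InUkClassB11 F N K k ε₀ U :=
  inUkClassB11_gaugeAct_iff _ U

/-- ★ **THE CENTRED ROOTED GAUGE OF THE SELECTOR LIES IN (2)'s CLASS AS SOON AS `U_k(V)` DOES** (DEF-1's `recordBgFieldC := rootGaugeC (k+1) (recordBgField …)` shape).
[cite: Balaban1985Variational, Thm 1 p.279, (2) p.278, (19) p.281; Balaban1987RG1, (0.21) p.256] -/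
theorem inUkClassB11_rootGaugeC_ukSel_of_uk (hk : k ≤ (F.P K).m + (F.P K).K) {V : GaugeField (F.P K) k (SU N)} (hex : UkExists F N K k ε V)
    (huniq : UniqueUkOrbit F N K k ε V) (hcl : InUkClassB11 F N K k ε₀ (Uk F N K k ε V)) : InUkClassB11 F N K k ε₀ (rootGaugeC k (UkSel F N K k ε V)) :=
  (inUkClassB11_rootGaugeC_iff _).2 (inUkClassB11_ukSel_of_uk hk hex huniq hcl)

end Glue

/-! ## §1  The GL pin with `hqon` discharged from the class letter -/

section InClass

variable (K k : ℕ) (Ω : ℕ → Set (Site (F.P K) 0)) (U₀ : GaugeField (F.P K) 0 (SU N))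
variable [Fact (0 < (F.L : ℝ))] [Fact (0 < (F.P K).eta k)] [Fact (0 < c0Rec F K k)] [Fact (∀ c, 0 < wBRec F K k c)]

/-- ★★★ **THE GL PIN, IN-CLASS EDITION — {W1}'s UN-FRAMED ONTO ROW DISCHARGED FROM THE PIN'S OWN CLASS LETTER**: ✓`…_of_entryRows_guarded` (✓p835253) with its binder
`hqon : Function.Surjective (qCplxOp k U₀)` ([B7] Sect. E's submersion row) DERIVED from `hcl : InUkClassB11 F N K k ε₀ U₀` ([B11] (2) at `Ω_j = T`) through dag-n07-e's
✓`qCplxOp_surjective_of_inUkClassB11` (v1.1 ✓p835435; MODULE 142–144 corrector road + lit ✓`InUkClassB11.mem_bgReg`), the framed `hQ` then by ✓`QprOfRecord_surjective_hierFrameGL_of_inUkClassB11`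
(= PT-B ✓p832507 fed with that row; proof-irrelevant, so the consumers' `h0∕h1` at ANY `hQ` fit); `0 ≤ ε₀` dropped (✓`eps_pos_of_inUkClassB11`).  NEW displayed rows: the four
`ε₀` ceilings `h3 h2 hst hstδ`.  REMAINING content letters: `hpos` ({W1} framed half), {W2} `h0∕h1`, {W3} `hS∕hR`, {W4} `h157` + `r + r ≤ α₁`, the k-free window `hq`, (14) `hreg`,
`∀ x, x ∈ Ω_k`, `hcl`, numeric rows; conclusion `Prop4UniformPrAtRecord … r Gp E R′` with `nJ := ε₀` in `E` (verbatim the guarded edition's).  Glue BY NAME; nothing of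
[B7]∕[B9]∕[B11] proved; {W1}–{W4} INHABITED NOWHERE.
[cite: Balaban1985Variational, Prop. 4 (97)–(98) pp.292–293, (2) p.278, (8) p.279, (14) p.280, (28) p.282, (44)–(46) p.285, (72)–(73) p.289, (86)–(89) p.291, (103) p.293; Balaban1985Averaging, Proposition 5 (157) p.42, Prop. 2 (52)–(54) p.26, (84)–(92) pp.30–31; Balaban1985BackgroundPropagators, Thm 3.12 (3.132)–(3.133) p.422, (3.13)–(3.16) p.393, (3.113)–(3.115) p.418; Balaban1987RG1, (1.2) p.260] -/
theorem prop4UniformPrAtRecord_node00_of_prop5Clause_hierFrameGLRec_of_entryRows_inClass (levB : PBond (F.P K) k → ℕ) (a : ℝ)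
    (hpos : ∀ x, x ≠ 0 → 0 < RCLike.re ⟪x, laplaceAOfRecord F N k U₀ (QprOfRecord F N k U₀ (hierFrameGLDatumOfRecord F N k U₀)) (QprimeOfRecord F N k U₀) a x⟫_ℂ)
    (Gp : SiteL2K ℂ (F.P K).d (fun _ => (F.P K).sitesPerDir 0) (c0Rec F K k) (WRec N) →ₗ[ℂ]
      SiteL2K ℂ (F.P K).d (fun _ => (F.P K).sitesPerDir 0) (c0Rec F K k) (WRec N))
    {α ε₀ : ℝ} (hkpos : 0 < k) (hkm : k ≤ (F.P K).m + (F.P K).K) (hΩ : ∀ x, x ∈ Ω k) (hαpos : 0 < α) (hα : α * (11000000 * N) ≤ 1)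
    (hreg : ∀ j, j < k → PlaqSmall (α * ((F.L : ℝ) ^ j * (F.P K).eta k) ^ 2) (Averaging.iter (avOfRecord F N K) j U₀))
    -- {W1}'s un-framed onto row `hqon` AND the current letter `‖J(U₀)‖ ≤ nJ` BOTH from [B11] (2)'s class letter `hcl` (dag-n07-e ✓p835435 `qCplxOp_surjective_of_inUkClassB11`;
    -- ✓`norm_JOfRecordAtBg_le_of_inUkClassB11`, `nJ := ε₀`), at the price of MODULE 144's four ceilings on `ε₀` (`0 < ε₀` is forced by the class: ✓`eps_pos_of_inUkClassB11`)
    (h3 : (143 * (((((F.P K).d + 4 : ℕ) : ℝ)) ^ 2 / 4) ^ 2) * ε₀ ≤ 1 / 3)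
    (h2 : 2 * ε₀ ≤ 2 * deltaSU (Fin N) / ((((F.P K).d + 4) * (F.P K).L : ℕ) : ℝ) ^ 2)
    (hst : stokesConst (F.P K) * (2 * ε₀) < emlWeight (F.P K) / 16) (hstδ : stokesConst (F.P K) * (2 * ε₀) < deltaSU (Fin N))
    (hcl : InUkClassB11 F N K k ε₀ U₀)
    -- {W2} := the (3.133) entry rows of `H₁^{pr}(U₀)` at `(B₀, ρ)` ([B9] Thm 3.12; lane N07) — DISPLAYED
    {B₀ ρ : ℝ} (hB₀ : 0 ≤ B₀) (hρ : 0 < ρ)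
    (h0 : ∀ y'' y : PBond (F.P K) k, entry0 F N K k Ω U₀ levB (H1prOfRecordAtBg F N K k Ω U₀ (hierFrameGLDatumOfRecord F N k U₀) levB a hpos
      (QprOfRecord_surjective_hierFrameGL_of_inUkClassB11 hkm (eps_pos_of_inUkClassB11 hcl) h3 h2 hst hstδ hcl)) y'' y ≤ B₀ * Real.exp (-(ρ * (Site.tdist y''.src y.src : ℝ))))
    (h1 : ∀ y'' y : PBond (F.P K) k, entry1 F N K k Ω U₀ levB (H1prOfRecordAtBg F N K k Ω U₀ (hierFrameGLDatumOfRecord F N k U₀) levB a hpos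
      (QprOfRecord_surjective_hierFrameGL_of_inUkClassB11 hkm (eps_pos_of_inUkClassB11 hcl) h3 h2 hst hstδ hcl)) y'' y ≤ B₀ * Real.exp (-(ρ * (Site.tdist y''.src y.src : ℝ))))
    -- (KL-C)ᵖʳ := the (157) clause of `B7.Prop5Printed (kexpOfRecordPr F N 𝔥ᴳᴸ)` at `(α, α₁, C₃)`, `r + r ≤ α₁`, and the window
    {C₃ α₁ : ℝ} (hC₃ : 0 ≤ C₃)
    (h157 : ∀ (i : KRecIdx F) (W₀ : (kexpOfRecordPr F N (fun K k (U : GaugeField (F.P K) 0 (SU N)) => hierFrameGLDatumOfRecord F N k U) i).Cfg), (kexpOfRecordPr F N (fun K k (U : GaugeField (F.P K) 0 (SU N)) => hierFrameGLDatumOfRecord F N k U) i).plaqDevEta W₀ < α →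
      ∀ A : (kexpOfRecordPr F N (fun K k (U : GaugeField (F.P K) 0 (SU N)) => hierFrameGLDatumOfRecord F N k U) i).Fld, (kexpOfRecordPr F N (fun K k (U : GaugeField (F.P K) 0 (SU N)) => hierFrameGLDatumOfRecord F N k U) i).fldNorm A < α₁ → (kexpOfRecordPr F N (fun K k (U : GaugeField (F.P K) 0 (SU N)) => hierFrameGLDatumOfRecord F N k U) i).dCk W₀ A ≤ C₃ * (kexpOfRecordPr F N (fun K k (U : GaugeField (F.P K) 0 (SU N)) => hierFrameGLDatumOfRecord F N k U) i).fldNorm A)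
    (hrα₁ : letI b : ℝ := B₀ * ((F.P K).d * (2 * (1 + 1 / ρ)) ^ (F.P K).d)
      letI C₂ : ℝ := 281600000000000000 * (F.L : ℝ) * N
      letI c₄ : ℝ := 1 / (200000000000 * (F.L : ℝ) * N)
      letI r : ℝ := min (c₄ / 4) (min (1 / 2) (1 / (16 * (b * C₂ + 1))))
      r + r ≤ α₁)
    -- the window, k-FREE: `(r+r)·Θ_H·G = (r+r)·b·2dC₃ · ((L^d)^k η_k^d) = (r+r)·b·2dC₃` since `L^k η_k = 1`
    (hq : letI b : ℝ := B₀ * ((F.P K).d * (2 * (1 + 1 / ρ)) ^ (F.P K).d)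
      letI C₂ : ℝ := 281600000000000000 * (F.L : ℝ) * N
      letI c₄ : ℝ := 1 / (200000000000 * (F.L : ℝ) * N)
      letI r : ℝ := min (c₄ / 4) (min (1 / 2) (1 / (16 * (b * C₂ + 1))))
      (r + r) * b * (2 * ((F.P K).d : ℝ) * C₃) ≤ 1 / 2)
    -- {W3} := the locality rows of the current reader `Δπ(U₀; G′, Q′)` ([B11] (72)–(73)∕(86)–(89)): (L) fine majorants `s₀, s₁`, (R) block-aggregated row decay — DISPLAYED
    {s0 : Bond (F.P K).d (fun _ => (F.P K).sitesPerDir 0) → Bond (F.P K).d (fun _ => (F.P K).sitesPerDir 0) → ℝ} {s1 : Bond (F.P K).d (fun _ => (F.P K).sitesPerDir 0) → Bond (F.P K).d (fun _ => (F.P K).sitesPerDir 0) × Fin (F.P K).d → ℝ} (hs0 : ∀ b' x, 0 ≤ s0 b' x) (hs1 : ∀ b' p, 0 ≤ s1 b' p)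
    (hS : ∀ (A : Space115Lit F N K k Ω U₀) (b' : Bond (F.P K).d (fun _ => (F.P K).sitesPerDir 0)),
      ‖NegSup.equiv (levWeight (F.L : ℝ) ((F.P K).eta k) (bondLevLit F Ω k) 3) (Matrix (Fin N) (Fin N) ℂ) (DeltaPiCurOfRecord F N K k Ω U₀ Gp (QprimeOfRecord F N k U₀) A) b'‖ ≤
        ∑ x : Bond (F.P K).d (fun _ => (F.P K).sitesPerDir 0), s0 b' x * ‖JetSup.equiv _ _ _ A x‖ +
        ∑ p : Bond (F.P K).d (fun _ => (F.P K).sitesPerDir 0) × Fin (F.P K).d, s1 b' p * ‖(nabla115 ((F.P K).eta k) (unitsOfRecord F N U₀)) (JetSup.equiv _ _ _ A) p‖)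
    {Cπ σ : ℝ} (hCπ : 0 ≤ Cπ) (hσ : 0 < σ)
    (hR : ∀ (b' : Bond (F.P K).d (fun _ => (F.P K).sitesPerDir 0)) (y'' : PBond (F.P K) k),
      blockRow0 F K k s0 b' y'' + blockRow1 F K k s1 b' y'' ≤
        Cπ * Real.exp (-(σ * (Site.tdist (blkOfBond F K k b').src y''.src : ℝ)))) :
    letI b : ℝ := B₀ * ((F.P K).d * (2 * (1 + 1 / ρ)) ^ (F.P K).d)
    letI ΘHw : ℝ := ((((F.P K).L ^ (F.P K).d) ^ k : ℕ) : ℝ) * b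
    letI N₁ : ℝ := Cπ * B₀ * ((F.P K).d * (2 * (1 + 1 / (min σ ρ / 2))) ^ (F.P K).d) * ((F.P K).d * (2 * (1 + 1 / (min σ ρ / 2))) ^ (F.P K).d)
    letI Θ' : ℝ := ((((F.P K).L ^ (F.P K).d) ^ k : ℕ) : ℝ) * N₁
    letI C₂ : ℝ := 281600000000000000 * (F.L : ℝ) * N
    letI c₄ : ℝ := 1 / (200000000000 * (F.L : ℝ) * N)
    letI r : ℝ := min (c₄ / 4) (min (1 / 2) (1 / (16 * (b * C₂ + 1))))
    letI R' : ℝ := min r ((1 - 4 * b * C₂ * (r + r)) * (1 / 16))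
    letI CV : ℝ := 1024 * (((F.P K).d - 1 : ℕ) : ℝ) * ((1 : ℝ) * 1) ^ 3 * N * (α * (1 : ℝ) ^ 2 + 1 / 16)
        + (((F.P K).d - 1 : ℕ) : ℝ) * ((1 : ℝ) * 1) ^ 3 * (136 + 2 * ((1 : ℝ) * 1)) * N
    letI G : ℝ := 2 * ((F.P K).d : ℝ) * (C₃ * (F.P K).eta k ^ (F.P K).d)
    letI θ₃ : ℝ := (2 * (1 / (1 - 4 * b * C₂ * (r + r))) + 1) * ΘHw * G / r
    letI θE : ℝ := 2 * ΘHw * G * (1 / (1 - 4 * b * C₂ * (r + r)))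
    letI θE' : ℝ := 2 * Θ' * G * (1 / (1 - 4 * b * C₂ * (r + r)))
    Prop4UniformPrAtRecord F N K k Ω U₀ (hierFrameGLDatumOfRecord F N k U₀) levB a hpos
      (QprOfRecord_surjective_hierFrameGL_of_inUkClassB11 hkm (eps_pos_of_inUkClassB11 hcl) h3 h2 hst hstδ hcl) r Gp
      ((N * θ₃ * ε₀ + (N₁ * C₂ * (1 / (1 - 4 * b * C₂ * (r + r))) ^ 2 + N * θE')
        + N * θE * (N₁ * C₂ * (1 / (1 - 4 * b * C₂ * (r + r))) ^ 2) * R'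
        + N * (1 + θE * R') * CV * (1 / (1 - 4 * b * C₂ * (r + r))) ^ 2)) R' := by
  exact prop4UniformPrAtRecord_node00_of_prop5Clause_hierFrameGLRec_of_entryRows_guarded F N K k Ω U₀ levB a hpos Gp hkpos hkm hΩ hαpos hα hreg
    (qCplxOp_surjective_of_inUkClassB11 hkm (eps_pos_of_inUkClassB11 hcl) h3 h2 hst hstδ hcl) hB₀ hρ h0 h1 hC₃ h157 hrα₁ hq hs0 hs1 hS hCπ hσ hR
    (eps_pos_of_inUkClassB11 hcl).le hcl

end InClass

/-! ## §2  The in-class GL pin READ AT THE MINIMISER OF RECORD `UkSel F N K k ε V` -/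

section AtSelector

variable (K k : ℕ) (Ω : ℕ → Set (Site (F.P K) 0))
variable [Fact (0 < (F.L : ℝ))] [Fact (0 < (F.P K).eta k)] [Fact (0 < c0Rec F K k)] [Fact (∀ c, 0 < wBRec F K k c)]

/-- ★★★ **THE GL PIN AT THE MINIMISER OF RECORD** `U₀ := UkSel F N K k ε V` (lit `Node00.UkSel`: a measurable selector of the (0.21) minimisers over ₈a's class `bgReg … ε`, read in the
rooted gauge; DEF-1's `recordBgField F θ k K B = UkSel F 2 K (k+1) θ.εbg (unitField …)`), EVERY datum `V`: §1 with its class letter supplied in [B11] Thm 1's currency AT `V` —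
`hex : UkExists F N K k ε V` (solvable), `huniq : UniqueUkOrbit F N K k ε V` (one minimal orbit), `hcl : InUkClassB11 F N K k ε₀ (Uk F N K k ε V)` (the minimiser in (2)'s class at
`ε₀`; the (8)-type row) — by §0's `inUkClassB11_ukSel_of_uk`.  Everything else displayed verbatim at this `U₀` ({W1} `hpos`, {W2}, {W3}, {W4}, window, (14) `hreg` for `Ū^j(UkSel … V)`,
the four `ε₀` ceilings, numerics).  Glue BY NAME; Thm 1's rows, {W1}–{W4} INHABITED NOWHERE here.
[cite: Balaban1985Variational, Thm 1 p.279, Prop. 4 (97)–(98) pp.292–293, (2) p.278, (14) p.280, (19) p.281, (103) p.293; Balaban1987RG1, (0.21) p.256, (2.3) p.265; Balaban1985Averaging, Proposition 5 (157) p.42; Balaban1985BackgroundPropagators, Thm 3.12 (3.133) p.422] -/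
theorem prop4UniformPrAtRecord_node00_of_prop5Clause_hierFrameGLRec_of_entryRows_inClass_ukSel {ε : ℝ} (V : GaugeField (F.P K) k (SU N)) (levB : PBond (F.P K) k → ℕ) (a : ℝ)
    (hpos : ∀ x, x ≠ 0 → 0 < RCLike.re ⟪x, laplaceAOfRecord F N k (UkSel F N K k ε V) (QprOfRecord F N k (UkSel F N K k ε V) (hierFrameGLDatumOfRecord F N k (UkSel F N K k ε V))) (QprimeOfRecord F N k (UkSel F N K k ε V)) a x⟫_ℂ)
    (Gp : SiteL2K ℂ (F.P K).d (fun _ => (F.P K).sitesPerDir 0) (c0Rec F K k) (WRec N) →ₗ[ℂ]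
      SiteL2K ℂ (F.P K).d (fun _ => (F.P K).sitesPerDir 0) (c0Rec F K k) (WRec N))
    {α ε₀ : ℝ} (hkpos : 0 < k) (hkm : k ≤ (F.P K).m + (F.P K).K) (hΩ : ∀ x, x ∈ Ω k) (hαpos : 0 < α) (hα : α * (11000000 * N) ≤ 1)
    (hreg : ∀ j, j < k → PlaqSmall (α * ((F.L : ℝ) ^ j * (F.P K).eta k) ^ 2) (Averaging.iter (avOfRecord F N K) j (UkSel F N K k ε V)))
    -- {W1}'s un-framed onto row `hqon` AND the current letter `‖J(U₀)‖ ≤ nJ` BOTH from [B11] (2)'s class letter `hcl` (dag-n07-e ✓p835435 `qCplxOp_surjective_of_inUkClassB11`;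
    -- ✓`norm_JOfRecordAtBg_le_of_inUkClassB11`, `nJ := ε₀`), at the price of MODULE 144's four ceilings on `ε₀` (`0 < ε₀` is forced by the class: ✓`eps_pos_of_inUkClassB11`)
    (h3 : (143 * (((((F.P K).d + 4 : ℕ) : ℝ)) ^ 2 / 4) ^ 2) * ε₀ ≤ 1 / 3)
    (h2 : 2 * ε₀ ≤ 2 * deltaSU (Fin N) / ((((F.P K).d + 4) * (F.P K).L : ℕ) : ℝ) ^ 2)
    (hst : stokesConst (F.P K) * (2 * ε₀) < emlWeight (F.P K) / 16) (hstδ : stokesConst (F.P K) * (2 * ε₀) < deltaSU (Fin N))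
    -- [B11] Thm 1's rows AT THE DATUM `V` (DISPLAYED; the consumers' currency): solvable at radius `ε`, minimal orbit unique, the minimiser `U_k(V)` in (2)'s class at `ε₀`
    (hex : UkExists F N K k ε V) (huniq : UniqueUkOrbit F N K k ε V) (hcl : InUkClassB11 F N K k ε₀ (Uk F N K k ε V))
    -- {W2} := the (3.133) entry rows of `H₁^{pr}(U₀)` at `(B₀, ρ)` ([B9] Thm 3.12; lane N07) — DISPLAYED
    {B₀ ρ : ℝ} (hB₀ : 0 ≤ B₀) (hρ : 0 < ρ)
    (h0 : ∀ y'' y : PBond (F.P K) k, entry0 F N K k Ω (UkSel F N K k ε V) levB (H1prOfRecordAtBg F N K k Ω (UkSel F N K k ε V) (hierFrameGLDatumOfRecord F N k (UkSel F N K k ε V)) levB a hpos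
      (QprOfRecord_surjective_hierFrameGL_of_inUkClassB11 hkm (eps_pos_of_inUkClassB11 hcl) h3 h2 hst hstδ (inUkClassB11_ukSel_of_uk hkm hex huniq hcl))) y'' y ≤ B₀ * Real.exp (-(ρ * (Site.tdist y''.src y.src : ℝ))))
    (h1 : ∀ y'' y : PBond (F.P K) k, entry1 F N K k Ω (UkSel F N K k ε V) levB (H1prOfRecordAtBg F N K k Ω (UkSel F N K k ε V) (hierFrameGLDatumOfRecord F N k (UkSel F N K k ε V)) levB a hpos
      (QprOfRecord_surjective_hierFrameGL_of_inUkClassB11 hkm (eps_pos_of_inUkClassB11 hcl) h3 h2 hst hstδ (inUkClassB11_ukSel_of_uk hkm hex huniq hcl))) y'' y ≤ B₀ * Real.exp (-(ρ * (Site.tdist y''.src y.src : ℝ))))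
    -- (KL-C)ᵖʳ := the (157) clause of `B7.Prop5Printed (kexpOfRecordPr F N 𝔥ᴳᴸ)` at `(α, α₁, C₃)`, `r + r ≤ α₁`, and the window
    {C₃ α₁ : ℝ} (hC₃ : 0 ≤ C₃)
    (h157 : ∀ (i : KRecIdx F) (W₀ : (kexpOfRecordPr F N (fun K k (U : GaugeField (F.P K) 0 (SU N)) => hierFrameGLDatumOfRecord F N k U) i).Cfg), (kexpOfRecordPr F N (fun K k (U : GaugeField (F.P K) 0 (SU N)) => hierFrameGLDatumOfRecord F N k U) i).plaqDevEta W₀ < α →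
      ∀ A : (kexpOfRecordPr F N (fun K k (U : GaugeField (F.P K) 0 (SU N)) => hierFrameGLDatumOfRecord F N k U) i).Fld, (kexpOfRecordPr F N (fun K k (U : GaugeField (F.P K) 0 (SU N)) => hierFrameGLDatumOfRecord F N k U) i).fldNorm A < α₁ → (kexpOfRecordPr F N (fun K k (U : GaugeField (F.P K) 0 (SU N)) => hierFrameGLDatumOfRecord F N k U) i).dCk W₀ A ≤ C₃ * (kexpOfRecordPr F N (fun K k (U : GaugeField (F.P K) 0 (SU N)) => hierFrameGLDatumOfRecord F N k U) i).fldNorm A)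
    (hrα₁ : letI b : ℝ := B₀ * ((F.P K).d * (2 * (1 + 1 / ρ)) ^ (F.P K).d)
      letI C₂ : ℝ := 281600000000000000 * (F.L : ℝ) * N
      letI c₄ : ℝ := 1 / (200000000000 * (F.L : ℝ) * N)
      letI r : ℝ := min (c₄ / 4) (min (1 / 2) (1 / (16 * (b * C₂ + 1))))
      r + r ≤ α₁)
    -- the window, k-FREE: `(r+r)·Θ_H·G = (r+r)·b·2dC₃ · ((L^d)^k η_k^d) = (r+r)·b·2dC₃` since `L^k η_k = 1`
    (hq : letI b : ℝ := B₀ * ((F.P K).d * (2 * (1 + 1 / ρ)) ^ (F.P K).d)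
      letI C₂ : ℝ := 281600000000000000 * (F.L : ℝ) * N
      letI c₄ : ℝ := 1 / (200000000000 * (F.L : ℝ) * N)
      letI r : ℝ := min (c₄ / 4) (min (1 / 2) (1 / (16 * (b * C₂ + 1))))
      (r + r) * b * (2 * ((F.P K).d : ℝ) * C₃) ≤ 1 / 2)
    -- {W3} := the locality rows of the current reader `Δπ(U₀; G′, Q′)` ([B11] (72)–(73)∕(86)–(89)): (L) fine majorants `s₀, s₁`, (R) block-aggregated row decay — DISPLAYED
    {s0 : Bond (F.P K).d (fun _ => (F.P K).sitesPerDir 0) → Bond (F.P K).d (fun _ => (F.P K).sitesPerDir 0) → ℝ} {s1 : Bond (F.P K).d (fun _ => (F.P K).sitesPerDir 0) → Bond (F.P K).d (fun _ => (F.P K).sitesPerDir 0) × Fin (F.P K).d → ℝ} (hs0 : ∀ b' x, 0 ≤ s0 b' x) (hs1 : ∀ b' p, 0 ≤ s1 b' p)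
    (hS : ∀ (A : Space115Lit F N K k Ω (UkSel F N K k ε V)) (b' : Bond (F.P K).d (fun _ => (F.P K).sitesPerDir 0)),
      ‖NegSup.equiv (levWeight (F.L : ℝ) ((F.P K).eta k) (bondLevLit F Ω k) 3) (Matrix (Fin N) (Fin N) ℂ) (DeltaPiCurOfRecord F N K k Ω (UkSel F N K k ε V) Gp (QprimeOfRecord F N k (UkSel F N K k ε V)) A) b'‖ ≤
        ∑ x : Bond (F.P K).d (fun _ => (F.P K).sitesPerDir 0), s0 b' x * ‖JetSup.equiv _ _ _ A x‖ +
        ∑ p : Bond (F.P K).d (fun _ => (F.P K).sitesPerDir 0) × Fin (F.P K).d, s1 b' p * ‖(nabla115 ((F.P K).eta k) (unitsOfRecord F N (UkSel F N K k ε V))) (JetSup.equiv _ _ _ A) p‖)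
    {Cπ σ : ℝ} (hCπ : 0 ≤ Cπ) (hσ : 0 < σ)
    (hR : ∀ (b' : Bond (F.P K).d (fun _ => (F.P K).sitesPerDir 0)) (y'' : PBond (F.P K) k),
      blockRow0 F K k s0 b' y'' + blockRow1 F K k s1 b' y'' ≤
        Cπ * Real.exp (-(σ * (Site.tdist (blkOfBond F K k b').src y''.src : ℝ)))) :
    letI b : ℝ := B₀ * ((F.P K).d * (2 * (1 + 1 / ρ)) ^ (F.P K).d)
    letI ΘHw : ℝ := ((((F.P K).L ^ (F.P K).d) ^ k : ℕ) : ℝ) * b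
    letI N₁ : ℝ := Cπ * B₀ * ((F.P K).d * (2 * (1 + 1 / (min σ ρ / 2))) ^ (F.P K).d) * ((F.P K).d * (2 * (1 + 1 / (min σ ρ / 2))) ^ (F.P K).d)
    letI Θ' : ℝ := ((((F.P K).L ^ (F.P K).d) ^ k : ℕ) : ℝ) * N₁
    letI C₂ : ℝ := 281600000000000000 * (F.L : ℝ) * N
    letI c₄ : ℝ := 1 / (200000000000 * (F.L : ℝ) * N)
    letI r : ℝ := min (c₄ / 4) (min (1 / 2) (1 / (16 * (b * C₂ + 1))))
    letI R' : ℝ := min r ((1 - 4 * b * C₂ * (r + r)) * (1 / 16))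
    letI CV : ℝ := 1024 * (((F.P K).d - 1 : ℕ) : ℝ) * ((1 : ℝ) * 1) ^ 3 * N * (α * (1 : ℝ) ^ 2 + 1 / 16)
        + (((F.P K).d - 1 : ℕ) : ℝ) * ((1 : ℝ) * 1) ^ 3 * (136 + 2 * ((1 : ℝ) * 1)) * N
    letI G : ℝ := 2 * ((F.P K).d : ℝ) * (C₃ * (F.P K).eta k ^ (F.P K).d)
    letI θ₃ : ℝ := (2 * (1 / (1 - 4 * b * C₂ * (r + r))) + 1) * ΘHw * G / r
    letI θE : ℝ := 2 * ΘHw * G * (1 / (1 - 4 * b * C₂ * (r + r)))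
    letI θE' : ℝ := 2 * Θ' * G * (1 / (1 - 4 * b * C₂ * (r + r)))
    Prop4UniformPrAtRecord F N K k Ω (UkSel F N K k ε V) (hierFrameGLDatumOfRecord F N k (UkSel F N K k ε V)) levB a hpos
      (QprOfRecord_surjective_hierFrameGL_of_inUkClassB11 hkm (eps_pos_of_inUkClassB11 hcl) h3 h2 hst hstδ (inUkClassB11_ukSel_of_uk hkm hex huniq hcl)) r Gp
      ((N * θ₃ * ε₀ + (N₁ * C₂ * (1 / (1 - 4 * b * C₂ * (r + r))) ^ 2 + N * θE')
        + N * θE * (N₁ * C₂ * (1 / (1 - 4 * b * C₂ * (r + r))) ^ 2) * R'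
        + N * (1 + θE * R') * CV * (1 / (1 - 4 * b * C₂ * (r + r))) ^ 2)) R' :=
  prop4UniformPrAtRecord_node00_of_prop5Clause_hierFrameGLRec_of_entryRows_inClass F N K k Ω (UkSel F N K k ε V) levB a hpos Gp hkpos hkm hΩ hαpos hα hreg h3 h2 hst hstδ
    (inUkClassB11_ukSel_of_uk hkm hex huniq hcl) hB₀ hρ h0 h1 hC₃ h157 hrα₁ hq hs0 hs1 hS hCπ hσ hR

/-! ## §3  … and at its CENTRED ROOTED GAUGE `rootGaugeC k (UkSel F N K k ε V)` (DEF-1's `recordBgFieldC` shape) -/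

/-- ★★★ **THE GL PIN AT THE CENTRED ROOTED GAUGE OF THE MINIMISER OF RECORD** `U₀ := rootGaugeC k (UkSel F N K k ε V)` (DEF-1 ✓`RootedGaugeCentred.rootGaugeC`: signed in-block
comb from the `k`-block centres; `recordBgFieldC F θ k K B := rootGaugeC (k+1) (recordBgField F θ k K B)`), EVERY datum `V`: §1 with its class letter supplied from [B11] Thm 1's rows
AT `V` (`hex`, `huniq`, `hcl` as in §2) by §0's `inUkClassB11_rootGaugeC_ukSel_of_uk`; everything else displayed verbatim at this `U₀`.  Glue BY NAME; Thm 1's rows, {W1}–{W4}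
INHABITED NOWHERE here.
[cite: Balaban1985Variational, Thm 1 p.279, Prop. 4 (97)–(98) pp.292–293, (2) p.278, (14) p.280, (19) p.281, (103) p.293; Balaban1987RG1, (0.21) p.256, (2.3) p.265; Balaban1985Averaging, Proposition 5 (157) p.42; Balaban1985BackgroundPropagators, Thm 3.12 (3.133) p.422] -/
theorem prop4UniformPrAtRecord_node00_of_prop5Clause_hierFrameGLRec_of_entryRows_inClass_rootGaugeC_ukSel {ε : ℝ} (V : GaugeField (F.P K) k (SU N)) (levB : PBond (F.P K) k → ℕ) (a : ℝ)
    (hpos : ∀ x, x ≠ 0 → 0 < RCLike.re ⟪x, laplaceAOfRecord F N k (rootGaugeC k (UkSel F N K k ε V)) (QprOfRecord F N k (rootGaugeC k (UkSel F N K k ε V)) (hierFrameGLDatumOfRecord F N k (rootGaugeC k (UkSel F N K k ε V)))) (QprimeOfRecord F N k (rootGaugeC k (UkSel F N K k ε V))) a x⟫_ℂ)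
    (Gp : SiteL2K ℂ (F.P K).d (fun _ => (F.P K).sitesPerDir 0) (c0Rec F K k) (WRec N) →ₗ[ℂ]
      SiteL2K ℂ (F.P K).d (fun _ => (F.P K).sitesPerDir 0) (c0Rec F K k) (WRec N))
    {α ε₀ : ℝ} (hkpos : 0 < k) (hkm : k ≤ (F.P K).m + (F.P K).K) (hΩ : ∀ x, x ∈ Ω k) (hαpos : 0 < α) (hα : α * (11000000 * N) ≤ 1)
    (hreg : ∀ j, j < k → PlaqSmall (α * ((F.L : ℝ) ^ j * (F.P K).eta k) ^ 2) (Averaging.iter (avOfRecord F N K) j (rootGaugeC k (UkSel F N K k ε V))))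
    -- {W1}'s un-framed onto row `hqon` AND the current letter `‖J(U₀)‖ ≤ nJ` BOTH from [B11] (2)'s class letter `hcl` (dag-n07-e ✓p835435 `qCplxOp_surjective_of_inUkClassB11`;
    -- ✓`norm_JOfRecordAtBg_le_of_inUkClassB11`, `nJ := ε₀`), at the price of MODULE 144's four ceilings on `ε₀` (`0 < ε₀` is forced by the class: ✓`eps_pos_of_inUkClassB11`)
    (h3 : (143 * (((((F.P K).d + 4 : ℕ) : ℝ)) ^ 2 / 4) ^ 2) * ε₀ ≤ 1 / 3)
    (h2 : 2 * ε₀ ≤ 2 * deltaSU (Fin N) / ((((F.P K).d + 4) * (F.P K).L : ℕ) : ℝ) ^ 2)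
    (hst : stokesConst (F.P K) * (2 * ε₀) < emlWeight (F.P K) / 16) (hstδ : stokesConst (F.P K) * (2 * ε₀) < deltaSU (Fin N))
    -- [B11] Thm 1's rows AT THE DATUM `V` (DISPLAYED; the consumers' currency): solvable at radius `ε`, minimal orbit unique, the minimiser `U_k(V)` in (2)'s class at `ε₀`
    (hex : UkExists F N K k ε V) (huniq : UniqueUkOrbit F N K k ε V) (hcl : InUkClassB11 F N K k ε₀ (Uk F N K k ε V))
    -- {W2} := the (3.133) entry rows of `H₁^{pr}(U₀)` at `(B₀, ρ)` ([B9] Thm 3.12; lane N07) — DISPLAYED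
    {B₀ ρ : ℝ} (hB₀ : 0 ≤ B₀) (hρ : 0 < ρ)
    (h0 : ∀ y'' y : PBond (F.P K) k, entry0 F N K k Ω (rootGaugeC k (UkSel F N K k ε V)) levB (H1prOfRecordAtBg F N K k Ω (rootGaugeC k (UkSel F N K k ε V)) (hierFrameGLDatumOfRecord F N k (rootGaugeC k (UkSel F N K k ε V))) levB a hpos
      (QprOfRecord_surjective_hierFrameGL_of_inUkClassB11 hkm (eps_pos_of_inUkClassB11 hcl) h3 h2 hst hstδ (inUkClassB11_rootGaugeC_ukSel_of_uk hkm hex huniq hcl))) y'' y ≤ B₀ * Real.exp (-(ρ * (Site.tdist y''.src y.src : ℝ))))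
    (h1 : ∀ y'' y : PBond (F.P K) k, entry1 F N K k Ω (rootGaugeC k (UkSel F N K k ε V)) levB (H1prOfRecordAtBg F N K k Ω (rootGaugeC k (UkSel F N K k ε V)) (hierFrameGLDatumOfRecord F N k (rootGaugeC k (UkSel F N K k ε V))) levB a hpos
      (QprOfRecord_surjective_hierFrameGL_of_inUkClassB11 hkm (eps_pos_of_inUkClassB11 hcl) h3 h2 hst hstδ (inUkClassB11_rootGaugeC_ukSel_of_uk hkm hex huniq hcl))) y'' y ≤ B₀ * Real.exp (-(ρ * (Site.tdist y''.src y.src : ℝ))))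
    -- (KL-C)ᵖʳ := the (157) clause of `B7.Prop5Printed (kexpOfRecordPr F N 𝔥ᴳᴸ)` at `(α, α₁, C₃)`, `r + r ≤ α₁`, and the window
    {C₃ α₁ : ℝ} (hC₃ : 0 ≤ C₃)
    (h157 : ∀ (i : KRecIdx F) (W₀ : (kexpOfRecordPr F N (fun K k (U : GaugeField (F.P K) 0 (SU N)) => hierFrameGLDatumOfRecord F N k U) i).Cfg), (kexpOfRecordPr F N (fun K k (U : GaugeField (F.P K) 0 (SU N)) => hierFrameGLDatumOfRecord F N k U) i).plaqDevEta W₀ < α →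
      ∀ A : (kexpOfRecordPr F N (fun K k (U : GaugeField (F.P K) 0 (SU N)) => hierFrameGLDatumOfRecord F N k U) i).Fld, (kexpOfRecordPr F N (fun K k (U : GaugeField (F.P K) 0 (SU N)) => hierFrameGLDatumOfRecord F N k U) i).fldNorm A < α₁ → (kexpOfRecordPr F N (fun K k (U : GaugeField (F.P K) 0 (SU N)) => hierFrameGLDatumOfRecord F N k U) i).dCk W₀ A ≤ C₃ * (kexpOfRecordPr F N (fun K k (U : GaugeField (F.P K) 0 (SU N)) => hierFrameGLDatumOfRecord F N k U) i).fldNorm A)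
    (hrα₁ : letI b : ℝ := B₀ * ((F.P K).d * (2 * (1 + 1 / ρ)) ^ (F.P K).d)
      letI C₂ : ℝ := 281600000000000000 * (F.L : ℝ) * N
      letI c₄ : ℝ := 1 / (200000000000 * (F.L : ℝ) * N)
      letI r : ℝ := min (c₄ / 4) (min (1 / 2) (1 / (16 * (b * C₂ + 1))))
      r + r ≤ α₁)
    -- the window, k-FREE: `(r+r)·Θ_H·G = (r+r)·b·2dC₃ · ((L^d)^k η_k^d) = (r+r)·b·2dC₃` since `L^k η_k = 1`
    (hq : letI b : ℝ := B₀ * ((F.P K).d * (2 * (1 + 1 / ρ)) ^ (F.P K).d)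
      letI C₂ : ℝ := 281600000000000000 * (F.L : ℝ) * N
      letI c₄ : ℝ := 1 / (200000000000 * (F.L : ℝ) * N)
      letI r : ℝ := min (c₄ / 4) (min (1 / 2) (1 / (16 * (b * C₂ + 1))))
      (r + r) * b * (2 * ((F.P K).d : ℝ) * C₃) ≤ 1 / 2)
    -- {W3} := the locality rows of the current reader `Δπ(U₀; G′, Q′)` ([B11] (72)–(73)∕(86)–(89)): (L) fine majorants `s₀, s₁`, (R) block-aggregated row decay — DISPLAYED
    {s0 : Bond (F.P K).d (fun _ => (F.P K).sitesPerDir 0) → Bond (F.P K).d (fun _ => (F.P K).sitesPerDir 0) → ℝ} {s1 : Bond (F.P K).d (fun _ => (F.P K).sitesPerDir 0) → Bond (F.P K).d (fun _ => (F.P K).sitesPerDir 0) × Fin (F.P K).d → ℝ} (hs0 : ∀ b' x, 0 ≤ s0 b' x) (hs1 : ∀ b' p, 0 ≤ s1 b' p)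
    (hS : ∀ (A : Space115Lit F N K k Ω (rootGaugeC k (UkSel F N K k ε V))) (b' : Bond (F.P K).d (fun _ => (F.P K).sitesPerDir 0)),
      ‖NegSup.equiv (levWeight (F.L : ℝ) ((F.P K).eta k) (bondLevLit F Ω k) 3) (Matrix (Fin N) (Fin N) ℂ) (DeltaPiCurOfRecord F N K k Ω (rootGaugeC k (UkSel F N K k ε V)) Gp (QprimeOfRecord F N k (rootGaugeC k (UkSel F N K k ε V))) A) b'‖ ≤
        ∑ x : Bond (F.P K).d (fun _ => (F.P K).sitesPerDir 0), s0 b' x * ‖JetSup.equiv _ _ _ A x‖ +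
        ∑ p : Bond (F.P K).d (fun _ => (F.P K).sitesPerDir 0) × Fin (F.P K).d, s1 b' p * ‖(nabla115 ((F.P K).eta k) (unitsOfRecord F N (rootGaugeC k (UkSel F N K k ε V)))) (JetSup.equiv _ _ _ A) p‖)
    {Cπ σ : ℝ} (hCπ : 0 ≤ Cπ) (hσ : 0 < σ)
    (hR : ∀ (b' : Bond (F.P K).d (fun _ => (F.P K).sitesPerDir 0)) (y'' : PBond (F.P K) k),
      blockRow0 F K k s0 b' y'' + blockRow1 F K k s1 b' y'' ≤
        Cπ * Real.exp (-(σ * (Site.tdist (blkOfBond F K k b').src y''.src : ℝ)))) :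
    letI b : ℝ := B₀ * ((F.P K).d * (2 * (1 + 1 / ρ)) ^ (F.P K).d)
    letI ΘHw : ℝ := ((((F.P K).L ^ (F.P K).d) ^ k : ℕ) : ℝ) * b
    letI N₁ : ℝ := Cπ * B₀ * ((F.P K).d * (2 * (1 + 1 / (min σ ρ / 2))) ^ (F.P K).d) * ((F.P K).d * (2 * (1 + 1 / (min σ ρ / 2))) ^ (F.P K).d)
    letI Θ' : ℝ := ((((F.P K).L ^ (F.P K).d) ^ k : ℕ) : ℝ) * N₁
    letI C₂ : ℝ := 281600000000000000 * (F.L : ℝ) * N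
    letI c₄ : ℝ := 1 / (200000000000 * (F.L : ℝ) * N)
    letI r : ℝ := min (c₄ / 4) (min (1 / 2) (1 / (16 * (b * C₂ + 1))))
    letI R' : ℝ := min r ((1 - 4 * b * C₂ * (r + r)) * (1 / 16))
    letI CV : ℝ := 1024 * (((F.P K).d - 1 : ℕ) : ℝ) * ((1 : ℝ) * 1) ^ 3 * N * (α * (1 : ℝ) ^ 2 + 1 / 16)
        + (((F.P K).d - 1 : ℕ) : ℝ) * ((1 : ℝ) * 1) ^ 3 * (136 + 2 * ((1 : ℝ) * 1)) * N
    letI G : ℝ := 2 * ((F.P K).d : ℝ) * (C₃ * (F.P K).eta k ^ (F.P K).d)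
    letI θ₃ : ℝ := (2 * (1 / (1 - 4 * b * C₂ * (r + r))) + 1) * ΘHw * G / r
    letI θE : ℝ := 2 * ΘHw * G * (1 / (1 - 4 * b * C₂ * (r + r)))
    letI θE' : ℝ := 2 * Θ' * G * (1 / (1 - 4 * b * C₂ * (r + r)))
    Prop4UniformPrAtRecord F N K k Ω (rootGaugeC k (UkSel F N K k ε V)) (hierFrameGLDatumOfRecord F N k (rootGaugeC k (UkSel F N K k ε V))) levB a hpos
      (QprOfRecord_surjective_hierFrameGL_of_inUkClassB11 hkm (eps_pos_of_inUkClassB11 hcl) h3 h2 hst hstδ (inUkClassB11_rootGaugeC_ukSel_of_uk hkm hex huniq hcl)) r Gp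
      ((N * θ₃ * ε₀ + (N₁ * C₂ * (1 / (1 - 4 * b * C₂ * (r + r))) ^ 2 + N * θE')
        + N * θE * (N₁ * C₂ * (1 / (1 - 4 * b * C₂ * (r + r))) ^ 2) * R'
        + N * (1 + θE * R') * CV * (1 / (1 - 4 * b * C₂ * (r + r))) ^ 2)) R' :=
  prop4UniformPrAtRecord_node00_of_prop5Clause_hierFrameGLRec_of_entryRows_inClass F N K k Ω (rootGaugeC k (UkSel F N K k ε V)) levB a hpos Gp hkpos hkm hΩ hαpos hα hreg
    h3 h2 hst hstδ (inUkClassB11_rootGaugeC_ukSel_of_uk hkm hex huniq hcl) hB₀ hρ h0 h1 hC₃ h157 hrα₁ hq hs0 hs1 hS hCπ hσ hR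

end AtSelector

end Summit.QuantumFields.YangMills.Theorems.KExpOfRecordPr

end
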